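import Mathlib
import HarnessLib
import HarnessLib.Audit
import Summits.Parity.Statement
import Summits.Parity.BatemanHorn.Theorems.IsogenyRedeiTypeIMainTerm
import Summits.Parity.BatemanHorn.Theorems.IsogenyRedeiLambdaToCount
import HarnessLib.Audit.Status.Attr

/-!
Route: PolynomialMobius

DORMANT since 2026-08-24T18:38:43Z (reconciler: no traction for 7 d (last activity item-evidence-added at 2026-08-17T18:31:59Z); parked, not closed — `ledger route dormant route-Parity-PolynomialMobius --off` to reactivate) — unstaffed, not closed; items shared with open routes are served there. `ledger route dormant <id> --off` reactivates.

X_PM (PolynomialMobius). It suffices to show the MÖBIUS TAIL statement: for every Bateman–Horn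
system f = (f_1,…,f_k) there is η ∈ (0,1) with
  T_f(x) := ∑_{n ≤ x} ∑_{d_1 | f_1(n), …, d_k | f_k(n); d_1⋯d_k > x^{1−η}} ∏_i μ(d_i) log d_i =
o(x).
Reason: ∏_i Λ(f_i(n)) = (−1)^k ∑_{d_i | f_i(n)} ∏_i μ(d_i) log d_i (Λ = −(μ·log) ∗ 1, Mathlib
`ArithmeticFunction.sum_moebius_mul_log_eq`); the part with d_1⋯d_k ≤ x^{1−η} is Type-I with period
lcm(d) ≤ x^{1−η} (elementary count x·ρ(d)/lcm(d) + O(ρ(d))) and its main term is the log-weighted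
singular series, which converges to the Bateman–Horn constant C(f) (prime ideal theorem in the
splitting fields; support item TypeIMainTerm); so ∑_{n≤x} ∏_i Λ(f_i(n)) = C(f)·x + (−1)^k T_f(x) +
o(x), and partial summation (support item LambdaToCount; prime-power values are negligible) gives
Literature.NumberTheory.Sieve.BatemanHornAsymptotic f, i.e. the conjunct BatemanHorn. Reading of T_f
(k = 1): with e = f(n)/d, T_f is Möbius randomness of the LARGE COFACTOR f(n)/e along the roots of f
modulo e, e ≤ x^{deg f − 1 + η}; its e = 1 atom is ∑_{n≤x} μ(f(n)) = o(x), whose Liouville form is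
Chowla's 1965 polynomial conjecture.
Lean (X_PM = decl PolyMobiusTail; elaborates against Mathlib + Literature):
∀ (k : ℕ) (f : Fin k → Polynomial ℤ), Literature.NumberTheory.Sieve.IsBatemanHornSystem f → ∃ η : ℝ,
0 < η ∧ η < 1 ∧ (fun x : ℕ => ∑ n ∈ Finset.Icc 1 x, ∑ d ∈ Fintype.piFinset (fun i => (((f i).eval (n
: ℤ)).toNat).divisors), if (x : ℝ) ^ (1 - η) < ∏ i, (d i : ℝ) then ∏ i, ((ArithmeticFunction.moebius
(d i) : ℝ) * Real.log (d i)) else 0) =o[Filter.atTop] fun x : ℕ => (x : ℝ)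

Rationale: WHY THIS LINE. PROBLEMS.md §3 Parity bullet 4 ("Chowla/Elliott uniformity for λ along polynomial
sequences → parity-breaking input → BH") made exact. At Type-I level x^{1−η} — free for one-variable
polynomial sequences indexed by the argument n — Bombieri's indeterminacy
[BombieriAsymptoticSieve1976]
(Literature.NumberTheory.Sieve.bombieri_asymptotic_sieve_indeterminacy) says the whole of
BatemanHorn is the parity tail T_f, a correlation of μ with the divisor structure of polynomial
values. Area imported: multiplicative / pretentious number theory and its recent polynomial-value
theorems — [MatomakiRadziwillAnnals2016], [Tao2016], [TaoTeravainen2021] (Chowla-type results over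
ℤ), [GreenTao2012Mobius] (linear case) — and the two settings where the polynomial statements ARE
theorems: over F_q[T] (BH as q → ∞ by Galois/monodromy [Entin2016]; Chowla and twin primes for fixed
q [SawinShusterman2018], where the parity of Ω(f) is a sign of Frobenius), and on average over f
([BrowningSofosTeravainen2022]: BH and polynomial Chowla for 100% of f of fixed degree in
coefficient boxes). Consistency evidence: random sets with the Banks–Ford–Tao local structure
satisfy all BH statistics a.s. [BanksFord2026]. This is the only BatemanHorn-side route typed for
ALL systems (k, f), so its Assembly ends in the conjunct itself; the tail/main split is on the
PRODUCT d_1⋯d_k (a per-coordinate split is not Type-I for k ≥ 2: lcm(d) may exceed x).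
RANKED CRUXES.
 r2 PolyMobiusTail (X_PM itself; hardest; = the conjunct modulo theorem-grade glue).
 r3 PolyMobiusAtom: ∀ irreducible f, deg ≥ 2, lc > 0: ∑_{n≤x} μ(f(n)) = o(x) (the e = 1 atom of T_f;
open for every deg ≥ 2; n²+1 instance = neighbour of stmt-Parity-0615).
 r4 PolyChowla: ∑_{n≤x} λ(f(n)) = o(x) [Chowla1965] — same depth in Liouville form; the F_q[T] and
on-average theorems above are literally about this statement.
 support r9 (theorem-grade, provable with effort): TypeIMainTerm (elementary Type-I count +
log-weighted singular series → C(f): [Landau1903] prime ideal theorem with error term,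
[BatemanHorn1962] §2, [DavenportSchinzel1966];
Literature.NumberTheory.Sieve.exists_hasBatemanHornConst is the named fact for the unweighted
product); LambdaToCount (partial summation from ∏Λ-weights to polyPrimeCount; prime-power values
negligible: trivial for deg ≤ 2, Bombieri–Pila / Siegel for deg ≥ 3).
 r1 Assembly: PolyMobiusTail → TypeIMainTerm → LambdaToCount → BatemanHorn (the bookkeeping in the
thesis; provable).
KILL CRITERIA. r3 or r4 refuted for one f (μ or λ has non-zero mean along an irreducible polynomial)
refutes BatemanHorn for that f up to the glue — close the route and flag the conjunct. TypeIMainTerm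
refuted ⇒ my normalisation ((−1)^k, cutoff ∏ d_i ≤ x^{1−η}, constant C(f)) is wrong ⇒ pivot
(re-derive), do not close. PolyMobiusTail refuted while TypeIMainTerm ∧ LambdaToCount are proved ⇒
file ¬BatemanHorn.
NOT DECOMPOSED YET. Any attack on r2 beyond its atoms — the bilinear structure in (d, f(n)/d) is
where routes UnimodularColumns (deg 2) and CubicRoots (deg 3) live; log-averaged / almost-all-scales
weakenings of r3–r4 (entropy decrement); uniformity in f; k ≥ 2 interactions beyond the product
cutoff.

Novelty: NOVELTY (retriage planner, 2026-08-14; searches listed at the end were run BEFORE this claim).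
Nearest prior art FOUND: (i) SawinShusterman2022 = arXiv:2008.09905, §1.3 — the SAME mechanism over
F_q[u]: a convolution identity writes 1_prime through μ; range 1 = singular-series main term from
Euler products (= TypeIMainTerm), range 2 = uniform power-saving Möbius cancellation on polynomial
sequences F(f) (their Thm 1.3; = this route's k = 1 reading of the tail and cruxes r3/r4), range 3 =
quadratic values with a prime factor > sqrt ("not yet resolved over Z", Merikoski); quadratic BH
over F_q[u] follows (Thm 1.2). (ii) BombieriAsymptoticSieve1976 + Ford2004: Type-I level x^{1-ε}
fixes the Λ_k-asymptotics for k ≥ 2 and leaves exactly the parity tail open — the split at ∏ d_i ≤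
x^{1-η} is this dichotomy specialised to n ↦ (f_i(n)). (iii) Chowla1965 and arXiv:2010.07924
(Teräväinen 2024): r3, r4 are Chowla's polynomial conjecture (μ- and λ-form) verbatim. DELTA: no new
mechanism — the route is the ℤ-transcription of the SS2022 template, typed for ALL systems (k, f)
with a product cutoff (the only BatemanHorn route whose Assembly ends in the conjunct itself),
isolating the tail T_f as one Lean statement with explicit kill criteria; expected grade
known/variant; its value is organisational (an exact typed target for any parity-breaking input
along polynomial values). Searches: `lit search "Möbius cancellation polynomial sequences
Bateman-Horn"` (local + zbMATH/Crossref; OpenAlex/S2  [refs: 2008.09905, 2010.07924, SawinShusterman2022, BombieriAsymptoticSieve1976, Ford2004, Chowla1965]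

Barriers (technique_class: asymptotic-sieve type-I singular-series polynomial-chowla): BARRIERS (catalogue Literature/Barriers/Parity: 23 files listed, structured blocks read for the 10
named here; 2026-08-14).
Literature.Barriers.Parity.SelbergParityBarrier : APPLIES and is NOT evaded — Type-I data at any
level < 1 fix only the main term (TypeIMainTerm; Bombieri's indeterminacy
Literature.NumberTheory.Sieve.bombieri_asymptotic_sieve_indeterminacy), so the route relocates the
whole obstruction into crux PolyMobiusTail, to be met by non-sieve input (Möbius randomness along
the divisor structure of polynomial values); the bet is that multiplicative / F_q[u]-inspired
methods can reach T_f, for which no instance of degree ≥ 2 exists over ℤ.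
Literature.Barriers.Parity.FordFixedLevelBarrier : applies to the letter (one fixed level x^{1-η})
but not in substance — nothing is deduced from R(ν) alone: the tail is an explicit hypothesis (r2),
polynomial sequences have Type-I data at every level < 1, and Ford's sequences are purpose-built,
not polynomial values (scope caveat).
Literature.Barriers.Parity.FordMaynardLowLevel and
Literature.Barriers.Parity.FordMaynardMinimalTypeII : APPLY to any Type-I/II attack on r2 — the
values of one polynomial of degree d ≥ 2 are a thin set (c = 1 - 1/d ≥ 1/2): Type-I level γ =
(1-η)/d < 1/2 in their normalisation and NO Type-II range is available (FordMaynard2024 §2.4); the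
route uses no Type-II information, so it "evades" only by asking in r2 for input outside the
(I)/(II) framework — honest form: it does not evade, it names what is mi

Novelty grade: variant — route-review grade (refuter rreview1-Parity-PolynomialMobius). MECHANISM = the classical identity ∏Λ(f_i(n)) = (−1)^k Σ_{d_i|f_i(n)} ∏μ(d_i) log d_i split at a Type-I level, main term = log-weighted singular series → C(f), tail = Möbius cancellation along the divisor structure of polynomial values.  (refuter refuter-rreview1-Parity-PolynomialMobius-4d6c5979-0, 2026-08-15T18:32:04Z; prior: arXiv:2008.09905 (Sawin–Shusterman 2022 §1.2–1.3: convolution identity, 3 ranges over F_q[u]; Thm 1.3 = polynomial Möbius cancellation), doi:10.4171/022-1/12 (Iwaniec ICM 2006 §6 (6.2)–(6.4): Λ = −Σ_{d|n} μ(d) log d split at the Type-I level D, 'the remaining part is critical for breaking the parity barrier'), BombieriAsymptoticSieve1976 (Type-I level x^{1−ε} fixes Λ_k, k ≥ 2; indeterminacy of the)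

History (route lifecycle, newest last):
- 2026-08-24T18:38:43Z · DORMANT — reconciler: no traction for 7 d (last activity item-evidence-added at 2026-08-17T18:31:59Z); parked, not closed — `ledger route dormant route-Parity-PolynomialM (operator:999:3071081)

sub-problem: BatemanHorn · status: dormant · opened planner-plan-Parity-BatemanHorn-0 2026-08-13T19:22:58Z · rev 3 · ledger route-Parity-PolynomialMobius
GENERATED by the gate from the ledger (D-0016/17). Provers cite these decls: `theorem foo : Summit.Parity.BatemanHorn.Theses.PolynomialMobius.<Decl> := …` in Summits/Parity/BatemanHorn/Theorems/<Name>.lean.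
-/

namespace Summit.Parity.BatemanHorn.Theses.PolynomialMobius

open scoped BigOperators Topology Manifold Classical MeasureTheory ProbabilityTheory Matrix InnerProductSpace ComplexConjugate ContinuousMap
open Filter Set Function TopologicalSpace MeasureTheory

attribute [summit_statement] _root_.BatemanHorn

/-- item stmt-Parity-0870 · crux · rank 2 · open · by planner
why it might fail: Given TypeIMainTerm it is EQUIVALENT to Λ-weighted BH for every system: the full parity tail. Type-I data of any level <1 cannot decide it (Bombieri1976, Ford2005); even over F_q[u], where polynomial Möbius cancellation is PROVED, SS2022 needed a 3rd range (prime factor of F(n) > sqrt) open over Z.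
sources: BombieriAsymptoticSieve1976 (decl Literature.NumberTheory.Sieve.bombieri_asymptotic_sieve_indeterminacy), Ford2004 Thm 1 (decl Literature.Barriers.Parity.FordFixedLevelBarrier), SawinShusterman2022 = arXiv:2008.09905 §1.3 pp.4-5 (convolution identity, three ranges; third range 'not yet resolved over Z', cf. Merikoski), decl Literature.Barriers.Parity.SelbergParityBarrier (Ford2004 §1), decl Literature.Barriers.Parity.FordMaynardLowLevel (FordMaynard2024PrimeSieves §2.4: thin sets with c >= 1/2, e.g. values of one polynomial of degree >= 2, admit no Type-II range), Mathlib ArithmeticFunction.sum_moebius_mul_log_eq (the identity the split rests on)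
[crux] X_PM, the Möbius tail: for every Bateman–Horn system f = (f_1..f_k) there is η ∈ (0,1) with
∑_{n≤x} ∑_{d_i | f_i(n), d_1⋯d_k > x^{1−η}} ∏_i μ(d_i) log d_i = o(x). Since ∏Λ(f_i(n)) = (−1)^k
∑_{d_i|f_i(n)} ∏ μ(d_i) log d_i and the complementary range d_1⋯d_k ≤ x^{1−η} is Type-I
(TypeIMainTerm), this is BatemanHorn minus theorem-grade glue. k = 1 reading: Möbius randomness of
the large cofactor f(n)/e along the roots of f mod e, e ≤ x^{deg f − 1 + η}. Open (parity). Sources: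
BombieriAsymptoticSieve1976 (indeterminacy), Entin2016 / SawinShusterman2018 (F_q[T] analogues are
theorems), BrowningSofosTeravainen2022 (true for 100% of f). -/
@[route_item "route-Parity-PolynomialMobius", crux]
def PolyMobiusTail : Prop :=
  ∀ (k : ℕ) (f : Fin k → Polynomial ℤ), Literature.NumberTheory.Sieve.IsBatemanHornSystem f → ∃ η : ℝ, 0 < η ∧ η < 1 ∧ (fun x : ℕ => ∑ n ∈ Finset.Icc 1 x, ∑ d ∈ Fintype.piFinset (fun i => (((f i).eval (n : ℤ)).toNat).divisors), if (x : ℝ) ^ (1 - η) < ∏ i, (d i : ℝ) then ∏ i, ((ArithmeticFunction.moebius (d i) : ℝ) * Real.log (d i)) else 0) =o[Filter.atTop] fun x : ℕ => (x : ℝ)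

/-- item stmt-Parity-0871 · crux · rank 3 · open · by planner
why it might fail: Open for every f of degree ≥2, even n²+1 ('the only resolved case is the linear one', SS2022 p.4): {f(n)} is x-sparse in [1,x^d], outside every range where Möbius cancellation is proved (MR2016 needs multiplicative structure in n). Over F_q[u] the inseparable analogue is FALSE (CCG 2008 Thm 4.8).
sources: SawinShusterman2022 = arXiv:2008.09905 p.4 (Chowla's conjecture on polynomial sequences; Thm 1.3 = F_q[u] analogue for separable F, q > 4e²k²p²), ConradConradGross2008 Thm 4.8 / Ex. 6.10 (decl Literature.Barriers.Parity.FunctionFieldMobiusBias: periodic, biased μ(f(g)) for inseparable f), Chowla1965 (the conjecture), BrowningSofosTeravainen2022 = arXiv:2212.10373 (true for 100% of f of fixed degree), MatomakiRadziwillAnnals2016 (short-interval technology; no polynomial-value version), Entin2016 (q → ∞ analogue)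
[crux] The e = 1 atom: for every irreducible f ∈ ℤ[X] of degree ≥ 2 with positive leading
coefficient, ∑_{n≤x} μ(f(n)) = o(x) (f(n) ≤ 0 contributes μ(0) = 0). Open for every degree ≥ 2
(linear = PNT in progressions; GreenTao2012Mobius is the linear/nilsequence theory). n²+1 instance:
neighbour of stmt-Parity-0615. Sources: Chowla1965; BrowningSofosTeravainen2022 (100% of f);
SawinShusterman2018 (F_q[T]). -/
@[route_item "route-Parity-PolynomialMobius"]
def PolyMobiusAtom : Prop :=
  ∀ f : Polynomial ℤ, Irreducible f → 2 ≤ f.natDegree → 0 < f.leadingCoeff → (fun x : ℕ => ∑ n ∈ Finset.Icc 1 x, (ArithmeticFunction.moebius ((f.eval (n : ℤ)).toNat) : ℝ)) =o[Filter.atTop] fun x : ℕ => (x : ℝ)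

/-- item stmt-Parity-0872 · crux · rank 4 · open · by planner
why it might fail: Chowla 1965 for irreducible deg ≥2: 'wide open for any polynomial with nonlinear irreducible factors' (Teräväinen arXiv:2010.07924 p.3); even infinitely many sign changes of λ(P(n)) is open for a general irreducible quadratic (p.7); squarefree values open from deg 4 (x⁴+2). Same sparsity wall as r3.
sources: arXiv:2010.07924 (Teräväinen, Amer. J. Math. 2024) pp.2-3 (Conj. 1.2, (1.1) 'wide open'), p.7 (irreducible quadratic sign changes open; x^4+2 squarefree values open), Chowla1965, SawinShusterman2018 = arXiv:1808.04001 (F_q[T] Chowla for fixed large q), Entin2016 (q → ∞), BrowningSofosTeravainen2022 = arXiv:2212.10373 (polynomial Chowla for 100% of f), decl Literature.Barriers.Parity.LogarithmicAveraging (log-averaged weakenings would not transfer to this unweighted statement)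
[crux] Chowla's polynomial conjecture (Liouville form, Chowla1965): for every irreducible f ∈ ℤ[X]
of degree ≥ 2 with positive leading coefficient, ∑_{n≤x} λ(f(n)) = o(x) (Mathlib
ArithmeticFunction.liouville; λ(0) = 0). Chowla states it for all f ≠ c·g²; irreducible is the case
this route needs. Open for deg ≥ 2. Sources: Chowla1965; TaoTeravainen2021 and
MatomakiRadziwillAnnals2016 (linear-shift technology); Entin2016, SawinShusterman2018 (function
fields). -/
@[route_item "route-Parity-PolynomialMobius", crux]
def PolyChowla : Prop :=
  ∀ f : Polynomial ℤ, Irreducible f → 2 ≤ f.natDegree → 0 < f.leadingCoeff → (fun x : ℕ => ∑ n ∈ Finset.Icc 1 x, (ArithmeticFunction.liouville ((f.eval (n : ℤ)).toNat) : ℝ)) =o[Filter.atTop] fun x : ℕ => (x : ℝ)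

/-- item stmt-Parity-0873 · support · rank 9 · closed · proved by Summit.Parity.BatemanHorn.Theorems.typeIMainTerm_proof (prover) · by planner
[support] Type-I main term, theorem-grade: for every BH system f and η ∈ (0,1) there is C with
HasBatemanHornConst f C and (−1)^k ∑_{n≤x} ∑_{d_i | f_i(n), d_1⋯d_k ≤ x^{1−η}} ∏ μ(d_i) log d_i ~
C·x. Proof sketch: #{n ≤ x : d_i | f_i(n) ∀ i} = x ρ(d)/lcm(d) + O(ρ(d)) (period lcm(d) ≤ x^{1−η});
the log-weighted singular series (−1)^k ∑_d ∏(μ(d_i) log d_i) ρ(d)/lcm(d) converges (ordered by the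
cutoff) to the Bateman–Horn constant C(f) = ∏_p (1−1/p)^{−k}(1−ω(p)/p) by the prime ideal theorem
with error term in the splitting fields (Landau1903; BatemanHorn1962 §2; DavenportSchinzel1966; k =
1, f = X: −∑ μ(d) log d/d = 1). Named fact available:
Literature.NumberTheory.Sieve.exists_hasBatemanHornConst. Provable with substantial effort;
grounders may propose the needed Dedekind-zeta facts as Literature cites. -/
@[route_item "route-Parity-PolynomialMobius", crux]
def TypeIMainTerm : Prop :=
  ∀ (k : ℕ) (f : Fin k → Polynomial ℤ), Literature.NumberTheory.Sieve.IsBatemanHornSystem f → ∀ η : ℝ, 0 < η → η < 1 → ∃ C : ℝ, 0 < C ∧ Literature.NumberTheory.Sieve.HasBatemanHornConst f C ∧ Asymptotics.IsEquivalent Filter.atTop (fun x : ℕ => (-1 : ℝ) ^ k * ∑ n ∈ Finset.Icc 1 x, ∑ d ∈ Fintype.piFinset (fun i => (((f i).eval (n : ℤ)).toNat).divisors), if ∏ i, (d i : ℝ) ≤ (x : ℝ) ^ (1 - η) then ∏ i, ((ArithmeticFunction.moebius (d i) : ℝ) * Real.log (d i)) else 0) (fun x : ℕ => C * (x : ℝ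))

/-- `TypeIMainTerm` holds: proved by `Summit.Parity.BatemanHorn.Theorems.typeIMainTerm_proof`. -/
theorem TypeIMainTerm_holds : TypeIMainTerm := _root_.Summit.Parity.BatemanHorn.Theorems.typeIMainTerm_proof

/-- item stmt-Parity-0874 · support · rank 9 · closed · proved by Summit.Parity.BatemanHorn.LambdaToCount.lambdaToCount_proof (prover) · by planner
[support] From Λ-weights to the count, theorem-grade: if ∑_{n≤x} ∏_i Λ(f_i(n)) ~ C·x with
HasBatemanHornConst f C then BatemanHornAsymptotic f (polyPrimeCount f x ~ C/(∏ deg f_i) · x/(log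
x)^k). Partial summation (Λ(f_i(n)) = log f_i(n) = deg f_i · log n + O(1) at prime values) plus
negligibility of proper prime-power values f_i(n) = p^a, a ≥ 2: O(x^{1/2+ε}) — trivial for deg ≤ 2,
Bombieri–Pila / Siegel integral points on y^a = f_i(x) for deg ≥ 3. C > 0 by
Literature.NumberTheory.Sieve.exists_hasBatemanHornConst. -/
@[route_item "route-Parity-PolynomialMobius", crux]
def LambdaToCount : Prop :=
  ∀ (k : ℕ) (f : Fin k → Polynomial ℤ), Literature.NumberTheory.Sieve.IsBatemanHornSystem f → ∀ C : ℝ, 0 < C → Literature.NumberTheory.Sieve.HasBatemanHornConst f C → Asymptotics.IsEquivalent Filter.atTop (fun x : ℕ => ∑ n ∈ Finset.Icc 1 x, ∏ i, ArithmeticFunction.vonMangoldt (((f i).eval (n : ℤ)).toNat)) (fun x : ℕ => C * (x : ℝ)) → Literature.NumberTheory.Sieve.BatemanHornAsymptotic f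

/-- `LambdaToCount` holds: proved by `Summit.Parity.BatemanHorn.LambdaToCount.lambdaToCount_proof`. -/
theorem LambdaToCount_holds : LambdaToCount := _root_.Summit.Parity.BatemanHorn.LambdaToCount.lambdaToCount_proof

/-- item stmt-Parity-0875 · assembly · rank 1 · open · by planner
[assembly] PolyMobiusTail → TypeIMainTerm → LambdaToCount → BatemanHorn. Given k, f,
IsBatemanHornSystem f: take η from PolyMobiusTail; ∏_i Λ(f_i(n)) = (−1)^k ∑_{d ∈ ∏ divisors(f_i(n))}
∏_i μ(d_i) log d_i (Mathlib ArithmeticFunction.sum_moebius_mul_log_eq per coordinate,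
Finset.prod_sum); split at ∏ d_i ≤ x^{1−η} (TypeIMainTerm: ~ C x) vs > x^{1−η} (tail: o(x));
IsEquivalent.add_isLittleO gives ∑∏Λ ~ C x (C ≠ 0 via
Literature.NumberTheory.Sieve.exists_hasBatemanHornConst or directly); LambdaToCount concludes
BatemanHornAsymptotic f; BatemanHorn := Literature.NumberTheory.Sieve.BatemanHornConjecture is ∀ k
f, IsBatemanHornSystem f → BatemanHornAsymptotic f. Provable now (bookkeeping only). -/
@[route_item "route-Parity-PolynomialMobius"]
def Assembly : Prop :=
  PolyMobiusTail → TypeIMainTerm → LambdaToCount → _root_.BatemanHorn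

/-! D-0027 §2.1 — DECIDING THEOREM (planner-authored via `route open/edit --closes-file`; by planner-rbadge-Parity-PolynomialMobius-4d6c5979-g2-0 2026-08-15T16:13:48Z):
its hypotheses are this route's items and its conclusion the sub-problem Statement (glue_lint), and it elaborates with this file. -/

/-- D-0027 §2.1 deciding theorem of route PolynomialMobius: the three load-bearing items
`PolyMobiusTail` (crux r2), `TypeIMainTerm` and `LambdaToCount` (support) imply the sub-problem
statement `BatemanHorn` (= `Literature.NumberTheory.Sieve.BatemanHornConjecture`). The proof is the
bookkeeping of the thesis: `∏ᵢ Λ(fᵢ(n)) = (−1)^k ∑_{dᵢ ∣ fᵢ(n)} ∏ᵢ μ(dᵢ) log dᵢ` (Mathlib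
`ArithmeticFunction.sum_moebius_mul_log_eq` per coordinate, `Finset.prod_neg`, `Finset.prod_univ_sum`),
the split of the divisor sum at `∏ dᵢ ≤ x^{1−η}` versus `x^{1−η} < ∏ dᵢ` (complementary), then
`IsEquivalent.add_isLittleO` and `LambdaToCount`. -/
@[closes "route-Parity-PolynomialMobius"] theorem closes (hTail : PolyMobiusTail) (hMain : TypeIMainTerm) (hCount : LambdaToCount) :
    _root_.BatemanHorn := by
  intro k f hf
  obtain ⟨η, hη0, hη1, hT⟩ := hTail k f hf
  obtain ⟨C, hC, hHas, hM⟩ := hMain k f hf η hη0 hη1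
  refine hCount k f hf C hC hHas ?_
  -- Λ = -(μ · log) ∗ 1, coordinatewise
  have hΛ : ∀ m : ℕ, ArithmeticFunction.vonMangoldt m
      = -∑ e ∈ m.divisors, ((ArithmeticFunction.moebius e : ℝ) * Real.log e) := by
    intro m
    have h := ArithmeticFunction.sum_moebius_mul_log_eq (n := m)
    simp only [ArithmeticFunction.log_apply] at h
    linarith
  -- step A: the product of the `Λ(fᵢ(n))` as a signed sum over divisor tuples
  have stepA : ∀ n : ℕ, (∏ i, ArithmeticFunction.vonMangoldt (((f i).eval (n : ℤ)).toNat))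
      = (-1 : ℝ) ^ k * ∑ d ∈ Fintype.piFinset (fun i => (((f i).eval (n : ℤ)).toNat).divisors),
          ∏ i, ((ArithmeticFunction.moebius (d i) : ℝ) * Real.log (d i)) := by
    intro n
    simp_rw [hΛ]
    rw [Finset.prod_neg, Finset.card_univ, Fintype.card_fin, Finset.prod_univ_sum]
  -- step B: the divisor sum splits into the Type-I range and the tail (complementary cut-offs)
  have stepB : ∀ x n : ℕ,
      (∑ d ∈ Fintype.piFinset (fun i => (((f i).eval (n : ℤ)).toNat).divisors),
          ∏ i, ((ArithmeticFunction.moebius (d i) : ℝ) * Real.log (d i)))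
      = (∑ d ∈ Fintype.piFinset (fun i => (((f i).eval (n : ℤ)).toNat).divisors),
          if ∏ i, (d i : ℝ) ≤ (x : ℝ) ^ (1 - η) then
            ∏ i, ((ArithmeticFunction.moebius (d i) : ℝ) * Real.log (d i)) else 0)
        + (∑ d ∈ Fintype.piFinset (fun i => (((f i).eval (n : ℤ)).toNat).divisors),
          if (x : ℝ) ^ (1 - η) < ∏ i, (d i : ℝ) then
            ∏ i, ((ArithmeticFunction.moebius (d i) : ℝ) * Real.log (d i)) else 0) := by
    intro x n
    rw [← Finset.sum_add_distrib]
    refine Finset.sum_congr rfl fun d _ => ?_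
    by_cases h : ∏ i, (d i : ℝ) ≤ (x : ℝ) ^ (1 - η)
    · rw [if_pos h, if_neg (not_lt.mpr h), add_zero]
    · rw [if_neg h, if_pos (not_le.mp h), zero_add]
  -- the tail, times `(-1)^k`, is `o(C·x)`
  have hB := (hT.const_mul_left ((-1 : ℝ) ^ k)).trans_isBigO
    (Asymptotics.isBigO_self_const_mul hC.ne' (fun x : ℕ => (x : ℝ)) Filter.atTop)
  refine (hM.add_isLittleO hB).congr_left (Filter.Eventually.of_forall fun x => ?_)
  simp only [Pi.add_apply]
  rw [← mul_add, ← Finset.sum_add_distrib, Finset.mul_sum]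
  refine Finset.sum_congr rfl fun n _ => ?_
  rw [stepA n, stepB x n]

end Summit.Parity.BatemanHorn.Theses.PolynomialMobius
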